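/-
Copyright (c) 2026 the pub-hodgecm-mathlib formalisation cell (harness21).  Prover seat hodgecm-mathlib-K2Liu-p09 (g2): Track B «K2-LIT»,
#184♮ = hLiu418 = stmt-HodgeConjecture-24832, unit U7 of the K2_Liu road: SOCKET O41.3 `sig_K2LiuIntertwiningConverges` PAID BY NAME; 2026-09-04.
-/
import Summits.HodgeConjecture.HodgeConjecture.Theorems.K2LiuIntertwiningConvergesOfE5          -- ★ p855821 (K2Liu-p06 g0): O41.3 modulo (E5′)
import Summits.HodgeConjecture.HodgeConjecture.Theorems.K2LiuSiegelEisensteinDoubledSummable    -- ★ p856279 (K2Liu-p09 g0): (E5′) `parabolicIntegral`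
import HarnessLib

/-!
# Crux `HLiu418`, Track B road `K2_Liu`, unit U7 «CONTINUATION ORGANS of #41», socket O41.3:
# `sig_K2LiuIntertwiningConverges` — THE SIEGEL INTERTWINING INTEGRAL CONVERGES ABSOLUTELY on `Re s > n/2`, PAID BY NAME

Cell `hodgecm-mathlib`, crux item hLiu418 = `stmt-HodgeConjecture-24832`; squad K2 ∕ K2Liu, prover K2Liu-p09 (g2).  THEOREMS ONLY; lane
`--supports stmt-HodgeConjecture-24832` (socket O41.3 of `Cruxes/HLiu418/Lines/K2_Liu_CurveThetaSigs_U7_ContinuationOrgans.lean` ED. 2 :72,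
type VERBATIM = K2Liu-p06 (g0) REPORT-FIRST (ii) bytes; LEAD F0P6-plan ORIENT 2026-09-04T01:05:15Z «O41.3 :72 → p09 + p06»).

THE STATEMENT.  `H = U(𝕍 ⊕ −𝕍)(𝔸)` (★ `GRConstruction.HA`), `N_Δ(𝔸)` the unipotent radical of the Siegel parabolic (★ `unipDelta`), `w_Δ` the long
Weyl element of the Siegel cell (★ `weylDelta`).  For a unitary Hecke character `χ`, `Re s > n/2`, a CONTINUOUS Siegel section `f ∈ I_Δ(s, χ)`
(★ `IsSiegelDeltaSection`), every Haar measure `νN` on `N_Δ(𝔸)` and every `h ∈ H(𝔸)`, the intertwining integrand `u ↦ f(w_Δ u h)` is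
`νN`-integrable: `M(s)f(h) = ∫_{N_Δ(𝔸)} f(w_Δ u h) du` converges absolutely on Godement's half-plane.

THE PROOF (two ★ lines).  K2Liu-p06 (g0) closed the socket MODULO Godement's parabolic integral (E5′) —
★ `K2LiuIntertwiningConvergesOfE5.integrable_weylDelta_mul_of_parabolic` (majorant ★ `K2LiuIntertwiningMajorant`, big cell free
★ `K2LiuSiegelBigCellFree`, covering-weight unfolding ★ `K2LiuUnipotentCoveringWeight`, local boundedness of the #9 majorant
★ `K2LiuSiegelEisensteinMajorantLocallyBounded`, cocompactness ★ `K2LiuUnipotentCocompact`) — and (E5′) is now ★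
`K2LiuSiegelEisensteinDoubledSummable.parabolicIntegral` (Godement's lemma ★ `godement_parabolic_integral` on `P_Δ(𝔸) = M_Δ ⋉ N_Δ`, every `τ > 2n`).
This file composes the two: the single binder (E5′) of the modulo-closer is discharged by name.
[Moeglin–Waldspurger II.1.5–II.1.6; Godement, Sém. Bourbaki 257; Garrett (2018) §3.10.]

DEGENERATE CORNERS (as boxed for U7 ED. 1∕2).  `νN` is a binder with `[νN.IsHaarMeasure]` — no junk measure; `n = 0`: `N_Δ` trivial, a
continuous function on a compact group is integrable (and the chain handles it); `dV i = 0 ∕ dW j = 0` excluded by the binders; the abscissa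
`n/2` is #9's (same E5′, `τ = 2 Re s + n > 2n`).

HONEST LABEL.  This file pays organ-socket O41.3 of #41 `sig_K2LiuSiegelEisensteinContinuation`; by itself it retires no named input: `HC_CM` is
proved only modulo the 7 printed citations (2 remaining named inputs: hLiu418 = `stmt-HodgeConjecture-24832`, h413 = `stmt-HodgeConjecture-24833`)
until rung 0 closes.
-/

set_option autoImplicit false
-- the mandated namespace repeats the single-problem summit's segment (`HodgeConjecture.HodgeConjecture`)
set_option linter.dupNamespace false

noncomputable section

open scoped Matrix ENNReal NNReal
open NumberField IsDedekindDomain MeasureTheory Measure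

namespace Summit.HodgeConjecture.HodgeConjecture.Cruxes.HLiu418.K2LiuIntertwiningConverges

open Literature.NumberTheory.Automorphic Literature.NumberTheory.Automorphic.UnitaryGroup Literature.NumberTheory.GaloisRepresentations
open Literature.NumberTheory.GelbartRogawski1991 Literature.NumberTheory.GelbartRogawski1991.GRConstruction
open Literature.NumberTheory.K2Lit.SiegelDoubled
open Literature.MeasureTheory.Group
open Summit.HodgeConjecture.HodgeConjecture.Cruxes.HLiu418.K2LiuIntertwiningConvergesOfE5
open Summit.HodgeConjecture.HodgeConjecture.Cruxes.HLiu418.K2LiuSiegelEisensteinDoubledSummable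

variable (L : Type) [Field L] [NumberField L] [IsCMField L]
variable {N M n : ℕ} (e : Fin N × Fin M ≃ Fin n)
  (dV : Fin N → L) (hdV : ∀ i, IsCMField.complexConj L (dV i) = dV i)
  (dW : Fin M → L) (hdW : ∀ i, IsCMField.complexConj L (dW i) = dW i)

/-! ## §1 The intertwining integrand is integrable on `Re s > n/2` -/

/-- **THE SIEGEL INTERTWINING INTEGRAND IS HAAR-INTEGRABLE ON `N_Δ(𝔸)` for `Re s > n/2`** (`dV, dW ≠ 0`, unitary `χ`, continuous Siegel section
`f ∈ I_Δ(s,χ)`, any Haar measure `νN` on `N_Δ(𝔸)`, any `h`): ★ `integrable_weylDelta_mul_of_parabolic` with its one binder (E5′) discharged by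
★ `parabolicIntegral`. [cite: MoeglinWaldspurger1995, II.1.6 (Prop. (i) and its proof)] [cite: Garrett2018, §3.10] -/
theorem integrable_weylDelta_mul (hdV0 : ∀ i, dV i ≠ 0) (hdW0 : ∀ i, dW i ≠ 0)
    {χ : HeckeCharacter L} (hχ : χ.IsUnitary) {s : ℂ} (hs : (n : ℝ) / 2 < s.re)
    {f : HA L e dV hdV dW hdW → ℂ} (hf : IsSiegelDeltaSection L e dV hdV dW hdW χ s f) (hfc : Continuous f)
    [MeasurableSpace (unipDelta L e dV hdV dW hdW)] [BorelSpace (unipDelta L e dV hdV dW hdW)]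
    (νN : Measure (unipDelta L e dV hdV dW hdW)) [νN.IsHaarMeasure] (h : HA L e dV hdV dW hdW) :
    Integrable (fun u : unipDelta L e dV hdV dW hdW =>
      f (weylDelta L e dV hdV dW hdW * (u : HA L e dV hdV dW hdW) * h)) νN :=
  integrable_weylDelta_mul_of_parabolic L e dV hdV dW hdW hdV0 hdW0 hχ hs hf hfc νN
    (@fun _ _ τ hτ => parabolicIntegral L e dV hdV dW hdW hdV0 hdW0 τ hτ) h

/-! ## §2 The socket -/

/-- **SOCKET O41.3 `sig_K2LiuIntertwiningConverges` (type verbatim): THE INTERTWINING INTEGRAL CONVERGES ABSOLUTELY on `Re s > n/2`.**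
For every CM field `L`, non-degenerate doubled datum `(e, dV, dW)`, unitary Hecke character `χ`, `s` with `n/2 < Re s`, every continuous Siegel
section `f ∈ I_Δ(s,χ)`, every Haar measure `νN` on `N_Δ(𝔸)` and every `h ∈ H(𝔸)`: `u ↦ f(w_Δ · u · h)` is `νN`-integrable.  By `integrable_weylDelta_mul`.
[cite: MoeglinWaldspurger1995, II.1.6–II.1.7] [cite: Garrett2018, §3.10] -/
theorem intertwiningConverges :
    ∀ (L : Type) [Field L] [NumberField L] [IsCMField L] {N M n : ℕ} (e : Fin N × Fin M ≃ Fin n)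
      (dV : Fin N → L) (hdV : ∀ i, IsCMField.complexConj L (dV i) = dV i) (_hdV0 : ∀ i, dV i ≠ 0)
      (dW : Fin M → L) (hdW : ∀ i, IsCMField.complexConj L (dW i) = dW i) (_hdW0 : ∀ i, dW i ≠ 0)
      (χ : HeckeCharacter L), χ.IsUnitary →
        ∀ (s : ℂ), (n : ℝ) / 2 < s.re →
          ∀ f : HA L e dV hdV dW hdW → ℂ, IsSiegelDeltaSection L e dV hdV dW hdW χ s f → Continuous f →
            ∀ [MeasurableSpace (unipDelta L e dV hdV dW hdW)] [BorelSpace (unipDelta L e dV hdV dW hdW)]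
              (νN : Measure (unipDelta L e dV hdV dW hdW)) [νN.IsHaarMeasure]
              (h : HA L e dV hdV dW hdW),
                Integrable (fun u : unipDelta L e dV hdV dW hdW =>
                  f (weylDelta L e dV hdV dW hdW * (u : HA L e dV hdV dW hdW) * h)) νN :=
  fun L _ _ _ _ _ _ e dV hdV hdV0 dW hdW hdW0 _ hχ _ hs _ hf hfc _ _ νN _ h =>
    integrable_weylDelta_mul L e dV hdV dW hdW hdV0 hdW0 hχ hs hf hfc νN h

end Summit.HodgeConjecture.HodgeConjecture.Cruxes.HLiu418.K2LiuIntertwiningConverges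

end
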